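import Summits.BirchSwinnertonDyer.BirchSwinnertonDyer.Theorems.GenusKolyvaginAtTwoGenusPrimitiveSupplyAtTwoTwistingPrimeEntangledStrict
import Summits.BirchSwinnertonDyer.BirchSwinnertonDyer.Theorems.GenusKolyvaginAtTwoGenusPrimitiveSupplyAtTwoTwistingPrimeLevelFourTwin
import HarnessLib

/-!
# Route `GenusKolyvaginAtTwo`, crux #2 `GenusPrimitiveSupplyAtTwo` (stmt-BirchSwinnertonDyer-22136):
# THE ENTANGLEMENT CRITERION — a prime Heegner twin is entangled iff the curve's own `2`-Selmer group contains
# the level-`4` class and that class is strict at the twisting prime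

Width seat `bsd-line-gk2-p4` g10, cell `bsd-f1-sign2`; helper (`--supports stmt-BirchSwinnertonDyer-22136`), §48 of the
twisting-prime series (sequel of `…TwistingPrimeEntangledStrict`, §46–§47). THEOREMS ONLY: no definition, no named fact, no `sorry`; no item is closed; BSD is not proved by this.

SETTING (row 1 of the supply): `W/ℚ` globally minimal, `Δ_W < 0`, `ρ̄_{W,2}` onto; `K = ℚ(√−ℓ₀)` a PRIME Heegner field of the
supply menu (`ℓ₀` prime, `d_K = −ℓ₀`, all `q ∣ N_W` split, `2` split); `A = Wd` a globally minimal model of `W^{(d_K)}` with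
`#Sel₂(A) = 2`, `P ∈ A(ℚ) ∖ 2A(ℚ)` with a half `Q`. The twin is ENTANGLED when every `h ∈ Γ_{ℚ(E[4])}` fixes `Q`
(⟺ the Kummer class `κ(P)`, i.e. all of `Sel₂(A)`, dies on `Γ_{ℚ(E[4])}`; by `…TwistingPrimeLevelFour` this is the condition
at every level `2^M`).

* §46 `h1Eval_galoisCohomology_map` — `[H¹(φ)x, ρ] = φ[x, ρ]` for an intertwining `φ` of coefficient modules;
  `localization_eq_zero_of_selmer_of_forall_torsionFixing_four_h1Eval_eq_zero` — **an entangled Selmer class of the twist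
  is STRICT at the twisting prime**: for `v` odd, good for `W`, with `v(d)` odd, a class of `Sel₂(Wd)` dying on `Γ_{ℚ(E[4])}`
  has `loc_v = 0` (inertia at `v` fixes `E[4]`, so `loc_v` is unramified — `localization_mem_unramifiedSubgroup_of_forall_inertia`
  — while `𝓛_{Wd}(ℚ_v) ∩ H¹_ur = 0` is the lead's Lemma 2.11, `kummerLocalConditionAt_inf_unramifiedSubgroup_eq_bot_of_twist`).
* §47 CLASS-LEVEL TRANSPORT for the twist pair in X11b currency (`𝓐 = φ_*𝓚_{Wd}` agreeing with `𝓚_W` off `v₀`):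
  `exists_selmer_eq_map_of_localization_eq_zero` (a class of `Sel₂(W)` strict at `v₀` is `H¹(φ)` of a class of `Sel₂(Wd)`:
  `Sel_{v₀} ⊂ H¹_𝓐 = φ_* Sel₂(Wd)`) and `map_mem_selmer_of_localization_eq_zero` (a class of `Sel₂(Wd)` strict at `v₀` maps
  INTO `Sel₂(W)`: `H¹_𝓐 ⊂ Sel^{v₀}` plus `loc_{v₀} = 0`).
* §48 **THE CRITERION** `forall_torsionFixing_four_smul_eq_iff_exists_selmer` (prime Heegner twin over `ℚ`):
  ENTANGLED ⟺ ∃ `y ∈ Sel₂(W)`, `y ≠ 0`, `y` dies on `Γ_{ℚ(E[4])}` AND `y ∈ strictLocalKer W ℚ_{ℓ₀} 2`.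
  So entanglement is NOT a property of the twin alone: it requires that `W`'s own `2`-Selmer group be entangled («one of the
  three non-zero classes of `Sel₂(W)` is the level-`4` inflation class `ξ_W`», at most one by g8's
  `eq_of_forall_torsionFixing_four_h1Eval_eq_zero`), and then happens exactly at the `ℓ₀` where `ξ_W` is strict — a Čebotarev
  condition on `Frob_{ℓ₀}` in `Gal(ℚ(E[4])/ℚ)`. Corollary `exists_torsionFixing_four_smul_ne_of_selmer_disentangled`: **if every
  non-zero class of `Sel₂(W)` survives on `Γ_{ℚ(E[4])}` then NO prime Heegner twin of the menu is entangled** — the twin's point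
  condition of the depth-`M` supply (g8 p623549, g9 p630619, this seat's `…LevelFourTwin`) is then AUTOMATIC for every `K`.

This explains the census (DES13: 2/510 entangled twins): entangled twins occur only under curves `W` whose `Sel₂` contains `ξ_W`.
BSD is not proved by this; U (24947) is untouched.

References: [MazurRubin2010] Def. 3.1, Lemma 2.10–2.11, Prop. 3.3, Remark 2.4; [LawsonWuthrich2016] §3; [GrossLMS1991] §9
Prop. 9.1, 9.6; [SilvermanAEC2009] VII.4.1, X.4; [NeukirchANT1999] II (9.6).
-/

set_option linter.dupNamespace false -- tree convention: `Summit.BirchSwinnertonDyer.BirchSwinnertonDyer.Theorems` (summit = sub-problem)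
set_option autoImplicit false

noncomputable section

open scoped Classical Pointwise ContRepresentation

namespace Summit.BirchSwinnertonDyer.BirchSwinnertonDyer.Theorems.GenusKolyTwistingPrime

open WeierstrassCurve NumberField IsDedekindDomain Field Function
open Literature.NumberTheory.GaloisRepresentations Literature.NumberTheory.EllipticCurves
open Literature.NumberTheory
open Literature.NumberTheory.GaloisRepresentations.DiscreteGaloisModule (SelmerStructure unramifiedSubgroup)
open Literature.NumberTheory.GaloisCohomology
open Summit.BirchSwinnertonDyer.Rank1Residual.X11b.CongruentTransfer
open Summit.BirchSwinnertonDyer.Rank1Residual.X11b.Levels (map_map_eq_self_of_comp_eq)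
open Summit.BirchSwinnertonDyer.Rank1Residual.X11b.KummerPT (kummerStrict kummerRelaxed kummerStrict_of_mem
  kummerStrict_of_not_mem kummerRelaxed_of_mem kummerRelaxed_of_not_mem)
open Rat.HeightOneSpectrum (primesEquiv natGenerator)

universe u

/-! ## §48 The entanglement criterion for the prime Heegner twin over `ℚ` -/

section Criterion

open Summit.BirchSwinnertonDyer.BirchSwinnertonDyer.Theorems.GenusKolyTwistLocal

variable (W : WeierstrassCurve ℚ) [W.IsElliptic] [W.IsGloballyMinimal] {K : Type} [Field K] [NumberField K]

/-- **THE ENTANGLEMENT CRITERION, level spelled `((2 : ℕ) : ℤ)`** (X11b's Selmer-structure currency; the `(2 : ℤ)`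
spelling is `forall_torsionFixing_four_smul_eq_iff_exists_selmer` below). `W/ℚ` globally minimal with `Δ_W < 0`; `K`
imaginary quadratic with odd `d_K = −ℓ₀` (`ℓ₀` prime), Heegner for `N_W`, `2` split in `K`; `Wd` an elliptic model of
`W^{(d_K)}` with `#Sel₂(Wd) = 2`; `P ∈ Wd(ℚ)` with a half `Q` and no `Γ`-fixed half (`P ∉ 2Wd(ℚ)`). THEN every
`h ∈ Γ_{ℚ(E[4])}` fixes `Q` (ENTANGLED) IFF `Sel₂(W)` contains a NON-ZERO class dying on `Γ_{ℚ(E[4])}` and strict at `ℓ₀`.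
(⟹): `κ(P)` spans `Sel₂(Wd)`, dies on `Γ_{ℚ(E[4])}`, is strict at `ℓ₀` (§46) and transports into `Sel₂(W)` (§47) with the same
evaluations. (⟸): the class is the transport of some `c ∈ Sel₂(Wd) ∖ 0 = {κ(P)}` (§47), which then dies. UNCONDITIONAL.
[cite: MazurRubin2010, Def. 3.1, Lemma 2.10–2.11, Prop. 3.3 (arXiv:0904.3709 pp. 7–10)] [cite: LawsonWuthrich2016, §3]
[cite: GrossLMS1991, §9 Prop. 9.1] -/
theorem forall_torsionFixing_four_smul_eq_iff_exists_selmer_natCast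
    (hΔ : W.Δ < 0) (hK : IsImaginaryQuadratic K) (hodd : Odd (discr K))
    (hH : SatisfiesHeegnerHypothesis (W.conductorNorm ℤ) K) (h2K : ((Ideal.span {(2 : ℤ)}).primesOver (𝓞 K)).ncard = 2)
    {ℓ : ℕ} [Fact ℓ.Prime] (hd : discr K = -(ℓ : ℤ)) {Wd : WeierstrassCurve ℚ} [Wd.IsElliptic] {C : VariableChange ℚ}
    (hWd : C • W.quadraticTwist (discr K : ℚ) = Wd) (h2 : Nat.card (Wd.selmerGroup ((2 : ℕ) : ℤ)) = 2)
    (P : Wd.toAffine.Point) (Q : geomPoints Wd) (hQ : ((2 : ℕ) : ℤ) • Q = toGeomPoints Wd P)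
    (hP : ∀ T ∈ geomTorsion Wd ((2 : ℕ) : ℤ), Q - T ∉ MulAction.fixedPoints (absoluteGaloisGroup ℚ) (geomPoints Wd)) :
    (∀ h ∈ torsionFixing W (4 : ℤ), h • Q = Q) ↔
      ∃ y ∈ W.selmerGroup ((2 : ℕ) : ℤ), y ≠ 0 ∧ (∀ h ∈ torsionFixing W (4 : ℤ), h1Eval W ((2 : ℕ) : ℤ) y h = 0) ∧
        y ∈ MazurRubin2010.strictLocalKer W ℚ_[ℓ] ((2 : ℕ) : ℤ) := by
  classical
  haveI : Fact (Nat.Prime 2) := ⟨Nat.prime_two⟩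
  have hℓ : ℓ.Prime := Fact.out
  have e2 : ((2 : ℕ) : ℤ) = 2 := by norm_num
  have hn0 : ((2 : ℕ) : ℤ) ≠ 0 := by norm_num
  obtain ⟨hℓ2, hℓN, -⟩ := GenusKolyTwin.prime_discr_facts W hK hodd hH hℓ hd
  -- ### the place `v₀` over `ℓ` and its local data
  obtain ⟨v₀, hv₀⟩ : ∃ v : HeightOneSpectrum (𝓞 ℚ), ((primesEquiv v : Nat.Primes) : ℕ) = ℓ :=
    ⟨primesEquiv.symm ⟨ℓ, hℓ⟩, by rw [Equiv.apply_symm_apply]⟩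
  have hℓv₀ : (ℓ : 𝓞 ℚ) ∈ v₀.asIdeal := by
    rw [← hv₀]
    exact Rat.HeightOneSpectrum.natCast_natGenerator_mem v₀
  have hd0 : (discr K : ℚ) ≠ 0 := by
    rw [hd]
    push_cast
    exact neg_ne_zero.mpr (by exact_mod_cast hℓ.ne_zero)
  have hW : W.HasGoodReductionAt v₀ := by
    by_contra h
    exact hℓN (hv₀ ▸ (W.dvd_conductorNorm_iff v₀).mpr h)
  have h2v₀ : ((2 : ℕ) : 𝓞 ℚ) ∉ v₀.asIdeal :=
    natCast_not_mem_of_not_dvd hℓ hℓv₀ fun h ↦ hℓ2 ((Nat.prime_dvd_prime_iff_eq hℓ Nat.prime_two).mp h)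
  have h4v₀ : ((4 : ℤ) : 𝓞 ℚ) ∉ v₀.asIdeal := by
    have h4 : ((4 : ℕ) : 𝓞 ℚ) ∉ v₀.asIdeal :=
      natCast_not_mem_of_not_dvd hℓ hℓv₀ fun h ↦ hℓ2 ((Nat.prime_dvd_prime_iff_eq hℓ Nat.prime_two).mp
        (hℓ.dvd_of_dvd_pow (show ℓ ∣ 2 ^ 2 by simpa using h)))
    have e : ((4 : ℤ) : 𝓞 ℚ) = ((4 : ℕ) : 𝓞 ℚ) := by push_cast; rfl
    rw [e]
    exact h4
  have hram : ∃ π c : ℚ, v₀.valuation ℚ π = WithZero.exp (-1 : ℤ) ∧ (discr K : ℚ) = c ^ 2 * π :=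
    ⟨(discr K : ℚ), 1, by
      rw [hd]
      push_cast
      exact GenusKolyTwistRamified.valuation_neg_natCast_eq_exp_neg_one_of_mem v₀ hℓ hℓv₀,
      by rw [one_pow, one_mul]⟩
  -- ### the transport data: intertwining pair, transported structure, agreement off `v₀` (the place menu)
  obtain ⟨φ, ψ, hψφ, hφψ, hsplit⟩ := exists_intertwining_hsplit W hd0 hWd
  let 𝓐 : SelmerStructure (W.torsionGaloisModule ((2 : ℕ) : ℤ)) := fun v ↦
    (Wd.kummerSelmerStructure ((2 : ℕ) : ℤ) v).map
      (galoisCohomology.map (φ.restrictField (Place.Completion v)) 1)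
  have h𝓐 : ∀ v, 𝓐 v = (Wd.kummerSelmerStructure ((2 : ℕ) : ℤ) v).map
      (galoisCohomology.map (φ.restrictField (Place.Completion v)) 1) := fun _ ↦ rfl
  have hfin := twist_place_menu_finite_rat W hK.1 hH h2K hℓ hd hℓv₀ hWd
  have hinf := twist_place_menu_infinite_rat W hΔ hd0 hWd
  have hagree : ∀ v : Place ℚ, v ≠ Sum.inr v₀ → 𝓐 v = W.kummerSelmerStructure ((2 : ℕ) : ℤ) v := by
    rintro (w | v) hv
    · rcases hinf w with ⟨s, hs⟩ | ⟨hW', hWd'⟩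
      · rw [h𝓐, kummerSelmerStructure_apply, kummerSelmerStructure_apply]
        exact hsplit (Place.Completion (Sum.inl w)) ⟨s, hs⟩
      · rw [h𝓐, kummerSelmerStructure_apply, kummerSelmerStructure_apply]
        exact map_kummerLocalConditionAt_eq_of_eq_top W Wd ((2 : ℕ) : ℤ) (Place.Completion (Sum.inl w)) φ ψ hφψ
          (kummerLocalConditionAt_eq_top_of_forall_eq_zero Wd _ _ hWd')
          (kummerLocalConditionAt_eq_top_of_forall_eq_zero W _ _ hW')
    · have hvv₀ : v ≠ v₀ := fun h ↦ hv (by rw [h])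
      rcases hfin v hvv₀ with ⟨s, hs⟩ | ⟨h2v, hvW, hvWd⟩ | ⟨h2v, h1W, h1Wd⟩
      · rw [h𝓐, kummerSelmerStructure_apply, kummerSelmerStructure_apply]
        exact hsplit (Place.Completion (Sum.inr v)) ⟨s, hs⟩
      · exact transport_kummer_inr_eq_of_good W Wd 2 φ ψ hφψ 𝓐 h𝓐 h2v hvW hvWd
      · rw [h𝓐, kummerSelmerStructure_apply, kummerSelmerStructure_apply]
        exact map_kummerLocalConditionAt_adicCompletion_eq_of_natCard_ker_eq_one W Wd v two_ne_zero h2v h1W h1Wd φ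
  -- ### `Γ_{ℚ(E[4])} ≤ Γ_{ℚ(E[2])} = Γ_{ℚ(Wd[2])}`
  obtain ⟨ψ₂, hψ₂⟩ := exists_equivariant_addEquiv_geomTorsion_two_of_twist W hd0 hWd
  have hTd : torsionFixing W (2 : ℤ) ≤ torsionFixing Wd (2 : ℤ) :=
    torsionFixing_le_of_equivariant_addEquiv Wd W (2 : ℤ) ψ₂ hψ₂
  have hT4 : torsionFixing W (4 : ℤ) ≤ torsionFixing W (2 : ℤ) :=
    KolyvaginLowerBoundAtTwo.torsionFixing_le_of_dvd W (by norm_num)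
  have hT4' : torsionFixing W (4 : ℤ) ≤ torsionFixing W ((2 : ℕ) : ℤ) := by rw [e2]; exact hT4
  have hTd' : torsionFixing W (4 : ℤ) ≤ torsionFixing Wd ((2 : ℕ) : ℤ) := by rw [e2]; exact hT4.trans hTd
  -- ### the Kummer class `κ(P) ∈ Sel₂(Wd)`, non-zero, and its reading on `Q`
  have hdiv := Wd.zsmul_geomPoints_surjective_of_charZero (n := ((2 : ℕ) : ℤ)) hn0
  have hQfix : ((2 : ℕ) : ℤ) • Q ∈ MulAction.fixedPoints (absoluteGaloisGroup ℚ) (geomPoints Wd) := by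
    rw [hQ]; exact WeierstrassCurve.toGeomPoints_mem_fixedPoints Wd P
  set κ := WeierstrassCurve.kummerMapTorsion Wd ((2 : ℕ) : ℤ) hdiv P with hκdef
  have hκeq : κ = Wd.kummerClassTorsion ((2 : ℕ) : ℤ) Q hQfix := by
    rw [hκdef, WeierstrassCurve.kummerMapTorsion_apply,
      WeierstrassCurve.kummerMapTorsionFun_eq Wd ((2 : ℕ) : ℤ) hdiv P Q hQ]
  have hκS : κ ∈ Wd.selmerGroup ((2 : ℕ) : ℤ) :=
    (mem_selmerGroup_iff _ _ _).mpr ⟨fun _ ↦ WeierstrassCurve.kummerMapTorsion_mem_selmerLocalKer _ _ _ _ P,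
      fun _ ↦ WeierstrassCurve.kummerMapTorsion_mem_selmerLocalKer _ _ _ _ P⟩
  have hκ0 : κ ≠ 0 := by
    rw [hκeq]
    intro h0
    obtain ⟨T, hT, hfixT⟩ := (WeierstrassCurve.kummerClassTorsion_eq_zero_iff Wd ((2 : ℕ) : ℤ) Q hQfix).mp h0
    exact hP T hT hfixT
  have hread : ∀ h ∈ torsionFixing W (4 : ℤ), (h1Eval Wd ((2 : ℕ) : ℤ) κ h = 0 ↔ h • Q = Q) := fun h hh ↦ by
    rw [hκeq, ← ZeroMemClass.coe_eq_zero, coe_h1Eval_kummerClassTorsion Wd ((2 : ℕ) : ℤ) Q hQfix (hTd' hh),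
      sub_eq_zero]
  have hκS' : κ ∈ (Wd.kummerSelmerStructure ((2 : ℕ) : ℤ)).selmerGroup := by
    rw [← selmerGroup_eq_selmerGroup_kummerSelmerStructure]; exact hκS
  constructor
  · -- (⟹) entangled ⟹ `ξ_W := H¹(φ) κ ∈ Sel₂(W)`, non-zero, dying on `Γ_{ℚ(E[4])}`, strict at `ℓ₀`
    intro hfix
    have hκdies : ∀ h ∈ torsionFixing W (4 : ℤ), h1Eval Wd ((2 : ℕ) : ℤ) κ h = 0 := fun h hh ↦
      (hread h hh).mpr (hfix h hh)
    have hκv₀ : galoisCohomology.localization (Wd.torsionGaloisModule ((2 : ℕ) : ℤ)) (Sum.inr v₀) 1 κ ∈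
        Wd.kummerLocalConditionAt ((2 : ℕ) : ℤ) (v₀.adicCompletion ℚ) := by
      have h := (SelmerStructure.mem_selmerGroup_iff _ _).mp hκS' (Sum.inr v₀)
      rwa [kummerSelmerStructure_apply] at h
    have hloc0 := localization_eq_zero_of_kummer_of_forall_torsionFixing_four_h1Eval_eq_zero W hd0 hWd v₀ h2v₀ h4v₀ hW
      hram hκv₀ hκdies
    obtain ⟨hyS, hy0⟩ := map_mem_selmer_of_localization_eq_zero W Wd 2 φ 𝓐 h𝓐 v₀ hagree hκS' hloc0
    refine ⟨galoisCohomology.map φ 1 κ, ?_, ?_, ?_, ?_⟩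
    · rw [selmerGroup_eq_selmerGroup_kummerSelmerStructure]; exact hyS
    · intro h0
      apply hκ0
      have h := map_map_eq_self_of_comp_eq φ ψ hψφ κ
      rw [h0] at h
      rw [← h]
      exact map_zero _
    · intro h hh
      have e := h1Eval_galoisCohomology_map Wd W ((2 : ℕ) : ℤ) φ κ (ρ := h) (hT4' hh)
      rw [hκdies h hh, map_zero] at e
      exact e
    · subst hv₀
      exact mem_strictLocalKer_of_localization_eq_zero W v₀ hy0
  · -- (⟸) such a `y` is the transport of a class `c ∈ Sel₂(Wd) = {0, κ}`, so `κ` dies on `Γ_{ℚ(E[4])}`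
    rintro ⟨y, hyS, hy0, hydies, hystr⟩
    have hyS' : y ∈ (W.kummerSelmerStructure ((2 : ℕ) : ℤ)).selmerGroup := by
      rw [← selmerGroup_eq_selmerGroup_kummerSelmerStructure]; exact hyS
    have hloc : galoisCohomology.localization (W.torsionGaloisModule ((2 : ℕ) : ℤ)) (Sum.inr v₀) 1 y = 0 := by
      subst hv₀
      exact localization_eq_zero_of_mem_strictLocalKer W v₀ hystr
    obtain ⟨c, hcS, hcy⟩ := exists_selmer_eq_map_of_localization_eq_zero W Wd 2 φ ψ hψφ hφψ 𝓐 h𝓐 v₀ hagree hyS' hloc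
    have hc0 : c ≠ 0 := by
      rintro rfl
      apply hy0
      rw [← hcy]
      exact map_zero _
    have hcdies : ∀ h ∈ torsionFixing W (4 : ℤ), h1Eval Wd ((2 : ℕ) : ℤ) c h = 0 := by
      intro h hh
      have e := h1Eval_galoisCohomology_map Wd W ((2 : ℕ) : ℤ) φ c (ρ := h) (hT4' hh)
      rw [hcy, hydies h hh] at e
      have e'' := congrArg ψ e
      rw [map_zero, hψφ] at e''
      exact e''.symm
    have hcS' : c ∈ Wd.selmerGroup ((2 : ℕ) : ℤ) := by
      rw [selmerGroup_eq_selmerGroup_kummerSelmerStructure]; exact hcS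
    -- `Sel₂(Wd)` has exactly one non-zero element
    have hκc : κ = c := by
      obtain ⟨u, -, huniq⟩ := (Nat.card_eq_two_iff' (⟨0, zero_mem _⟩ : Wd.selmerGroup ((2 : ℕ) : ℤ))).mp h2
      have h1 := huniq ⟨κ, hκS⟩ (fun h ↦ hκ0 (congrArg Subtype.val h))
      have h2' := huniq ⟨c, hcS'⟩ (fun h ↦ hc0 (congrArg Subtype.val h))
      exact congrArg Subtype.val (h1.trans h2'.symm)
    intro h hh
    exact (hread h hh).mp (by rw [hκc]; exact hcdies h hh)

/-- **THE ENTANGLEMENT CRITERION** (the series' `(2 : ℤ)` spelling). `W/ℚ` globally minimal with `Δ_W < 0`; `K` imaginary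
quadratic with odd `d_K = −ℓ₀` (`ℓ₀` prime), Heegner for `N_W`, `2` split in `K` (the prime Heegner fields of the supply
menu); `Wd` an elliptic model of `W^{(d_K)}` with `#Sel₂(Wd) = 2`; `P ∈ Wd(ℚ)` with a half `Q` and `P ∉ 2Wd(ℚ)` (no
`Γ`-fixed half). THEN the twin is ENTANGLED — every `h ∈ Γ_{ℚ(E[4])}` fixes `Q`, i.e. `P` is halvable in `Wd(ℚ(E[4]))`,
equivalently (by `…TwistingPrimeLevelFour`) over every `ℚ(E[2^M])` — IF AND ONLY IF `Sel₂(W)` contains a NON-ZERO class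
`y` dying on `Γ_{ℚ(E[4])}` (the level-`4` inflation class `ξ_W`; at most one such, g8
`eq_of_forall_torsionFixing_four_h1Eval_eq_zero`) which is STRICT at `ℓ₀` (`y ∈ strictLocalKer W ℚ_{ℓ₀} 2`). So
entanglement of a twin REQUIRES `ξ_W ∈ Sel₂(W)` — a property of `W` alone — and then selects the `ℓ₀` at which `ξ_W` is
strict (a Čebotarev condition on `Frob_{ℓ₀}` in `Gal(ℚ(E[4])/ℚ)`). UNCONDITIONAL; BSD is not proved by this.
[cite: MazurRubin2010, Def. 3.1, Lemma 2.10–2.11, Prop. 3.3 (arXiv:0904.3709 pp. 7–10)] [cite: LawsonWuthrich2016, §3]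
[cite: GrossLMS1991, §9 Prop. 9.1] -/
theorem forall_torsionFixing_four_smul_eq_iff_exists_selmer
    (hΔ : W.Δ < 0) (hK : IsImaginaryQuadratic K) (hodd : Odd (discr K))
    (hH : SatisfiesHeegnerHypothesis (W.conductorNorm ℤ) K) (h2K : ((Ideal.span {(2 : ℤ)}).primesOver (𝓞 K)).ncard = 2)
    {ℓ : ℕ} [Fact ℓ.Prime] (hd : discr K = -(ℓ : ℤ)) {Wd : WeierstrassCurve ℚ} [Wd.IsElliptic] {C : VariableChange ℚ}
    (hWd : C • W.quadraticTwist (discr K : ℚ) = Wd) (h2 : Nat.card (Wd.selmerGroup 2) = 2)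
    (P : Wd.toAffine.Point) (Q : geomPoints Wd) (hQ : (2 : ℤ) • Q = toGeomPoints Wd P)
    (hP : ∀ T ∈ geomTorsion Wd (2 : ℤ), Q - T ∉ MulAction.fixedPoints (absoluteGaloisGroup ℚ) (geomPoints Wd)) :
    (∀ h ∈ torsionFixing W (4 : ℤ), h • Q = Q) ↔
      ∃ y ∈ W.selmerGroup 2, y ≠ 0 ∧ (∀ h ∈ torsionFixing W (4 : ℤ), h1Eval W (2 : ℤ) y h = 0) ∧
        y ∈ MazurRubin2010.strictLocalKer W ℚ_[ℓ] 2 := by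
  have e2 : (2 : ℤ) = ((2 : ℕ) : ℤ) := by norm_num
  rw [e2] at h2 hQ hP
  have h := forall_torsionFixing_four_smul_eq_iff_exists_selmer_natCast W hΔ hK hodd hH h2K hd hWd h2 P Q hQ hP
  rw [e2]
  exact h

/-- **Corollary: a SELMER-DISENTANGLED curve has NO entangled prime Heegner twin.** In the frame of the criterion, if EVERY
non-zero class of `Sel₂(W)` survives on `Γ_{ℚ(E[4])}` (on WALL row 1 at most one of the three can die, g8
`eq_of_forall_torsionFixing_four_h1Eval_eq_zero`), then for EVERY prime Heegner field `ℚ(√−ℓ₀)` of the menu and every model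
`Wd` of the twin with `#Sel₂(Wd) = 2`, `P ∈ Wd(ℚ) ∖ 2Wd(ℚ)`, some `h ∈ Γ_{ℚ(E[4])}` MOVES the half `Q` — the twin's point
condition of the depth-`M` supply (g8 p623549, g9 p630619, `…TwistingPrimeLevelFourTwin`) holds automatically, uniformly in
`K`. [cite: MazurRubin2010, Def. 3.1, Lemma 2.11, Prop. 3.3] [cite: LawsonWuthrich2016, §3] -/
theorem exists_torsionFixing_four_smul_ne_of_selmer_disentangled
    (hΔ : W.Δ < 0) (hK : IsImaginaryQuadratic K) (hodd : Odd (discr K))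
    (hH : SatisfiesHeegnerHypothesis (W.conductorNorm ℤ) K) (h2K : ((Ideal.span {(2 : ℤ)}).primesOver (𝓞 K)).ncard = 2)
    {ℓ : ℕ} [Fact ℓ.Prime] (hd : discr K = -(ℓ : ℤ)) {Wd : WeierstrassCurve ℚ} [Wd.IsElliptic] {C : VariableChange ℚ}
    (hWd : C • W.quadraticTwist (discr K : ℚ) = Wd) (h2 : Nat.card (Wd.selmerGroup 2) = 2)
    (hdis : ∀ y ∈ W.selmerGroup 2, y ≠ 0 → ∃ h ∈ torsionFixing W (4 : ℤ), h1Eval W (2 : ℤ) y h ≠ 0)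
    (P : Wd.toAffine.Point) (Q : geomPoints Wd) (hQ : (2 : ℤ) • Q = toGeomPoints Wd P)
    (hP : ∀ T ∈ geomTorsion Wd (2 : ℤ), Q - T ∉ MulAction.fixedPoints (absoluteGaloisGroup ℚ) (geomPoints Wd)) :
    ∃ h ∈ torsionFixing W (4 : ℤ), h • Q ≠ Q := by
  by_contra hcon
  push Not at hcon
  obtain ⟨y, hyS, hy0, hydies, -⟩ :=
    (forall_torsionFixing_four_smul_eq_iff_exists_selmer W hΔ hK hodd hH h2K hd hWd h2 P Q hQ hP).mp hcon
  obtain ⟨h, hh, hne⟩ := hdis y hyS hy0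
  exact hne (hydies h hh)


/-- **DEPTH-`M` SUPPLY OF THE AUXILIARY-FIELD FORM ON THE HABITAT WITH NO POINT CONDITION ON THE TWIN, for
SELMER-DISENTANGLED `W`.** `W/ℚ` globally minimal, `Δ_W < 0`, `2`-adic tower onto, `#Sel₂(W) = 4`, and EVERY non-zero class of
`Sel₂(W)` survives on `Γ_{ℚ(E[4])}` (`hdis`); `K = ℚ(√−ℓ₀)` a prime Heegner field of the menu (odd `d_K = −ℓ₀`, Heegner for `N_W`,
`2` split); `Wd` a globally minimal model of `W^{(d_K)}` with `#Sel₂(Wd) = 2` and a rational point `P ∉ 2Wd(ℚ)` (half `Q`, no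
`Γ`-fixed half). Then for every `M ≥ 1`, beyond every finite `B₀`: a prime `ℓ ≡ 7 (mod 8)`, Kolyvagin for `(E, K, 2)` of depth
`M` (`2^M ∣ ℓ + 1`, `2^M ∣ a_ℓ`), with every model of `W^{(−ℓ)}` having `#Sel₂ = 2` and every model of `Wd^{(−ℓ)}` having
`#Sel₂ = 1` — modulo cor34i (PRINT) ONLY: the twin's point condition of `…LevelFourTwin`'s capstone is discharged by the
entanglement criterion (`exists_torsionFixing_four_smul_ne_of_selmer_disentangled`). BSD is not proved by this.
[cite: MazurRubin2010, Cor. 3.4 (i), Prop. 3.3, Lemma 2.11, Lemma 3.5] [cite: LawsonWuthrich2016, §3]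
[cite: GrossLMS1991, §3 (3.1)–(3.3), §9 Prop. 9.1] -/
theorem exists_kolyvaginPrime_pow_genusPair_selmer_of_cor34i_of_selmer_disentangled
    (h34 : MazurRubin2010.cor34i_singleton_rat)
    (hρ : ∀ n : ℕ, 0 < n → W.HasSurjectiveModNGaloisRep ((2 : ℤ) ^ n)) (hΔ : W.Δ < 0)
    (h4 : Nat.card (W.selmerGroup 2) = 4)
    (hdis : ∀ y ∈ W.selmerGroup 2, y ≠ 0 → ∃ h ∈ torsionFixing W (4 : ℤ), h1Eval W (2 : ℤ) y h ≠ 0)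
    (hK : IsImaginaryQuadratic K) (hodd : Odd (discr K))
    (hH : SatisfiesHeegnerHypothesis (W.conductorNorm ℤ) K) (h2K : ((Ideal.span {(2 : ℤ)}).primesOver (𝓞 K)).ncard = 2)
    {ℓ₀ : ℕ} [Fact ℓ₀.Prime] (hd : discr K = -(ℓ₀ : ℤ))
    {Wd : WeierstrassCurve ℚ} [Wd.IsElliptic] [Wd.IsGloballyMinimal] {C : VariableChange ℚ}
    (hWd : C • W.quadraticTwist (discr K : ℚ) = Wd) (h2 : Nat.card (Wd.selmerGroup 2) = 2)
    (P : Wd.toAffine.Point) (Q : geomPoints Wd) (hQ : (2 : ℤ) • Q = toGeomPoints Wd P)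
    (hP : ∀ T ∈ geomTorsion Wd (2 : ℤ), Q - T ∉ MulAction.fixedPoints (absoluteGaloisGroup ℚ) (geomPoints Wd))
    {M : ℕ} (hM : 1 ≤ M) (B₀ : Finset ℕ) :
    ∃ ℓ : ℕ, ∃ _ : Fact ℓ.Prime, ℓ ∉ B₀ ∧ ℓ % 8 = 7 ∧ IsKolyvaginPrime (W.conductorNorm ℤ) W K 2 ℓ ∧
      FrobEqFrobInfty W K (2 ^ M) ℓ ∧ 2 ^ M ∣ ℓ + 1 ∧ ((2 : ℤ) ^ M) ∣ W.frobeniusTrace ℓ ∧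
      (∀ (W₁ : WeierstrassCurve ℚ) [W₁.IsElliptic],
        (∃ C₁ : VariableChange ℚ, C₁ • W.quadraticTwist (-(ℓ : ℚ)) = W₁) →
          Nat.card (W₁.selmerGroup 2) = 2) ∧
      (∀ (W₂ : WeierstrassCurve ℚ) [W₂.IsElliptic],
        (∃ C₂ : VariableChange ℚ, C₂ • Wd.quadraticTwist (-(ℓ : ℚ)) = W₂) →
          Nat.card (W₂.selmerGroup 2) = 1) :=
  exists_kolyvaginPrime_pow_genusPair_selmer_of_cor34i_of_half_four_of_habitat W h34 hρ hΔ h4 hK hWd h2 P Q hQ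
    (exists_torsionFixing_four_smul_ne_of_selmer_disentangled W hΔ hK hodd hH h2K hd hWd h2 hdis P Q hQ hP) hM B₀

end Criterion
end Summit.BirchSwinnertonDyer.BirchSwinnertonDyer.Theorems.GenusKolyTwistingPrime

end
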